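import Mathlib.RingTheory.SimpleModule.Basic
import Mathlib.LinearAlgebra.Projection
import Mathlib.LinearAlgebra.FiniteDimensional.Lemmas
import HarnessLib

/-!
# Graded modules with a degree-one endomorphism, II: retracts, cancellation, subgradings

This file is part of a small self-contained series (`GradedOrbitStrings`, `GradedOrbitRetract`,
`GradedOrbitReaching`, `GradedOrbitDegreewise`, `GradedOrbitConj`) proving the following
**conjugacy theorem** (`exists_graded_linearEquiv_conj`): let `R` be a ring containing a field
`K`, `M = ⨁_{k<N} gr k` a graded `R`-module, finite-dimensional over `K` and semisimple over
`R`, and `t`, `t'` two `R`-endomorphisms of degree `+1` which are *generic* — no non-zero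
`R`-endomorphism of degree `-1` commutes with them; then `t' = g t g⁻¹` for a degree-preserving
`R`-automorphism `g`.  For `R = K` this is the uniqueness of the rigid (= open-orbit)
representation of the equioriented quiver of type `A` with a given dimension vector; in the
language of Zelevinsky (*Induced representations of reductive 𝔭-adic groups II*, Ann. ÉNS 13
(1980), §§4, 8) it says that the multisegment with pairwise *unlinked* segments on a given
support is unique.  With `R = ℂ[W_K]` acting through a twisted Weil-group action it yields
A'Campo–Hevesi–Thorne–Whitmore, arXiv:2607.11763, Prop. 6.0.5 (2) (generic monodromy
operators on a fixed Frobenius-semisimple Weil representation form one orbit under the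
centraliser), see `Literature/NumberTheory/GaloisRepresentations/GenericWeilDeligneOrbitProofs`.

The proof is elementary and module-theoretic (no algebraic geometry, no Gabriel / Krull–Schmidt):
a *string* is `Z = ⨁_{r ≤ n} tʳ e(S)` for a simple `S` and `e : S → gr p`; a string born in a
degree `p` below which `S` does not occur splits off `t`-stably and compatibly with the grading
(`exists_isCompl_stringSum`); genericity passes to such summands; in a generic module the string
born at the bottom of a maximal interval of degrees occupied by `S` reaches its top
(`exists_comp_pow_ne_zero_of_occupied`); split off such longest strings for `t` and `t'`, cancel
the simple summands degreewise, and induct on `dim_K M`.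

Conventions.  Everything is stated without auxiliary definitions: a grading is a family
`gr : ℕ → Submodule R M` (with `iSupIndep gr`, `⨆ gr = ⊤` and `gr k = ⊥` for `k ≥ N` where
needed); "`t` has degree `+1`" is `∀ k, ∀ x ∈ gr k, t x ∈ gr (k + 1)`; a *string sum* is any
linear map `Ψ : (Fin (n+1) → S) →ₗ[R] M` with `Ψ s = ∑ r, t ^ (a + r) (e (s r))` (hypothesis
`hΨ`), so that lemmas apply to `∑ r, (t ^ r ∘ₗ e) ∘ₗ LinearMap.proj r` by `simp`.

## This file

* `forall_eq_zero_of_isCompl_restrict` — genericity (no non-zero degree `-1` endomorphism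
  commuting with `t`) passes to `t`-stable graded direct summands;
* `nonempty_linearEquiv_of_isCompl_of_isCompl` — **cancellation of a simple summand**:
  `N = A ⊕ B = A' ⊕ B'`, `A ≅ A'` simple `⟹ B ≅ B'` (projection along `A'`, or the modular
  law), for `R`-submodules of a finite-dimensional `K`-space, `K ⊆ R` a coefficient field
  (`finite_of_submodule`, `finrank_add_finrank_of_isCompl`,
  `exists_linearEquiv_of_injective_of_finrank_eq`);
* `iSupIndep_comap_subtype_of_isCompl` — a complement compatible with the grading inherits an
  independent exhaustive grading.
-/

namespace Literature.RepresentationTheory.Semisimple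

open Module

variable {R : Type*} [Ring R] {M : Type*} [AddCommGroup M] [Module R M]

/-- **Genericity passes to `t`-stable graded direct summands.**  If no non-zero degree `-1`
endomorphism of the graded module `M` commutes with `t`, and `M = Z ⊕ C` with `Z`, `C`
`t`-stable and the decomposition compatible with the grading, then the same holds for
`(C, t|_C)` (extend a degree `-1` map of `C` by zero on `Z`). [folklore] -/
theorem forall_eq_zero_of_isCompl_restrict (gr : ℕ → Submodule R M) (t : M →ₗ[R] M)
    (hgen : ∀ f : M →ₗ[R] M, (∀ x ∈ gr 0, f x = 0) → (∀ k, ∀ x ∈ gr (k + 1), f x ∈ gr k) →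
      f ∘ₗ t = t ∘ₗ f → f = 0)
    (Z C : Submodule R M) (hZC : IsCompl Z C) (hZt : ∀ x ∈ Z, t x ∈ Z) (hCt : ∀ x ∈ C, t x ∈ C)
    (hdeg : ∀ k, ∀ x ∈ gr k, ∃ z ∈ Z, ∃ y ∈ C, y ∈ gr k ∧ x = z + y)
    (f : C →ₗ[R] C) (hf0 : ∀ x ∈ (gr 0).comap C.subtype, f x = 0)
    (hf1 : ∀ k, ∀ x ∈ (gr (k + 1)).comap C.subtype, f x ∈ (gr k).comap C.subtype)
    (hft : f ∘ₗ (t.restrict hCt) = (t.restrict hCt) ∘ₗ f) : f = 0 := by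
  set π : M →ₗ[R] C := Submodule.projectionOnto C Z hZC.symm with hπ
  have hπZ : ∀ z ∈ Z, π z = 0 := fun z hz =>
    (Submodule.projectionOnto_apply_eq_zero_iff hZC.symm).mpr hz
  have hπC : ∀ y : C, π y = y := fun y => Submodule.projectionOnto_apply_left hZC.symm y
  set F : M →ₗ[R] M := C.subtype ∘ₗ f ∘ₗ π with hF
  have hFy : ∀ (y : M) (hy : y ∈ C), F y = f ⟨y, hy⟩ := by
    intro y hy
    change (f (π y) : M) = f ⟨y, hy⟩
    rw [hπC ⟨y, hy⟩]
  have hF : F = 0 := by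
    refine hgen F ?_ ?_ ?_
    · intro x hx
      obtain ⟨z, hz, y, hy, hy0, rfl⟩ := hdeg 0 x hx
      rw [map_add, hFy y hy, hf0 ⟨y, hy⟩ hy0]
      change (f (π z) : M) + 0 = 0
      rw [hπZ z hz, map_zero, add_zero]; rfl
    · intro k x hx
      obtain ⟨z, hz, y, hy, hyk, rfl⟩ := hdeg (k + 1) x hx
      rw [map_add, hFy y hy]
      have h1 : (F z) = 0 := by
        change (f (π z) : M) = 0
        rw [hπZ z hz, map_zero]; rfl
      rw [h1, zero_add]
      exact hf1 k ⟨y, hy⟩ hyk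
    · ext x
      obtain ⟨z, hz, y, hy, rfl⟩ := Submodule.mem_sup.mp
        ((hZC.sup_eq_top.symm ▸ Submodule.mem_top : x ∈ Z ⊔ C))
      simp only [LinearMap.comp_apply, map_add]
      rw [hFy _ (hCt y hy), hFy y hy]
      have h1 : F (t z) = 0 := by
        change (f (π (t z)) : M) = 0
        rw [hπZ _ (hZt z hz), map_zero]; rfl
      have h2 : F z = 0 := by
        change (f (π z) : M) = 0
        rw [hπZ z hz, map_zero]; rfl
      rw [h1, h2, zero_add, map_zero, zero_add]
      have h3 := congr($hft ⟨y, hy⟩)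
      simp only [LinearMap.comp_apply] at h3
      have h4 : (t.restrict hCt) ⟨y, hy⟩ = ⟨t y, hCt y hy⟩ := rfl
      rw [h4] at h3
      rw [h3, LinearMap.coe_restrict_apply]
  apply LinearMap.ext
  intro y
  apply Subtype.ext
  have h := hFy y y.2
  rw [hF, LinearMap.zero_apply] at h
  simp only [Subtype.coe_eta] at h
  rw [LinearMap.zero_apply, Submodule.coe_zero]
  exact h.symm

section Cancellation

variable (K : Type*) [Field K] [Algebra K R] {N : Type*} [AddCommGroup N] [Module K N]
  [Module R N] [IsScalarTower K R N]

/-- A submodule over `R` of a finite-dimensional `K`-space (`K ⊆ R` a coefficient field) is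
finite-dimensional over `K`. [folklore] -/
theorem finite_of_submodule [FiniteDimensional K N] (A : Submodule R N) : Module.Finite K A :=
  Module.Finite.of_injective (A.subtype.restrictScalars K) Subtype.val_injective

/-- For complementary submodules, the dimensions (over a coefficient field `K ⊆ R`) add up.
[folklore] -/
theorem finrank_add_finrank_of_isCompl [FiniteDimensional K N] {A B : Submodule R N}
    (h : IsCompl A B) : finrank K A + finrank K B = finrank K N := by
  haveI := finite_of_submodule K A
  haveI := finite_of_submodule K B
  rw [← Module.finrank_prod, ← ((Submodule.prodEquivOfIsCompl A B h).restrictScalars K).finrank_eq]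

/-- A submodule that is the internal direct sum of two submodules `P`, `Q` (`P ⊓ Q = ⊥`,
`P ⊔ Q = B`) is isomorphic to `P × Q`. [folklore] -/
theorem nonempty_equiv_prod_of_disjoint_sup_eq {B P Q : Submodule R N} (hPQ : Disjoint P Q)
    (hsup : P ⊔ Q = B) : Nonempty (B ≃ₗ[R] (P × Q)) := by
  have hP : P ≤ B := hsup ▸ le_sup_left
  have hQ : Q ≤ B := hsup ▸ le_sup_right
  have hc : IsCompl (P.comap B.subtype) (Q.comap B.subtype) := by
    refine ⟨?_, ?_⟩
    · rw [Submodule.disjoint_def]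
      intro x hxP hxQ
      have := (Submodule.disjoint_def.mp hPQ) (x : N) hxP hxQ
      exact Subtype.ext this
    · rw [codisjoint_iff, eq_top_iff]
      rintro ⟨x, hx⟩ -
      rw [← hsup] at hx
      obtain ⟨u, hu, v, hv, rfl⟩ := Submodule.mem_sup.mp hx
      exact Submodule.mem_sup.mpr ⟨⟨u, hP hu⟩, hu, ⟨v, hQ hv⟩, hv, rfl⟩
  exact ⟨(Submodule.prodEquivOfIsCompl _ _ hc).symm ≪≫ₗ
    ((Submodule.comapSubtypeEquivOfLe hP).prodCongr (Submodule.comapSubtypeEquivOfLe hQ))⟩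

/-- An injective `R`-linear map between modules of the same finite `K`-dimension is an
isomorphism. [folklore] -/
theorem exists_linearEquiv_of_injective_of_finrank_eq {N' : Type*} [AddCommGroup N']
    [Module K N'] [Module R N'] [IsScalarTower K R N'] [FiniteDimensional K N]
    [FiniteDimensional K N'] (f : N →ₗ[R] N') (hf : Function.Injective f)
    (hdim : finrank K N = finrank K N') : ∃ g : N ≃ₗ[R] N', ∀ x, g x = f x := by
  have hsurj : Function.Surjective f := by
    have := (LinearMap.injective_iff_surjective_of_finrank_eq_finrank hdim
      (f := f.restrictScalars K)).mp hf
    exact this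
  exact ⟨LinearEquiv.ofBijective f ⟨hf, hsurj⟩, fun x => rfl⟩

/-- **Cancellation of a simple direct summand.**  If `N = A ⊕ B = A' ⊕ B'` with `A ≅ A'`
simple, then `B ≅ B'` (elementary: project `B` to `B'` along `A'`; if this is not injective then
`A' ≤ B`, and symmetrically, and in the remaining case `B = A' ⊕ (B ⊓ B')`,
`B' = A ⊕ (B ⊓ B')` by the modular law). [folklore] -/
theorem nonempty_linearEquiv_of_isCompl_of_isCompl [FiniteDimensional K N]
    (A B A' B' : Submodule R N)
    (hAB : IsCompl A B) (hA'B' : IsCompl A' B') [IsSimpleModule R A] (eA : A ≃ₗ[R] A') :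
    Nonempty (B ≃ₗ[R] B') := by
  haveI : IsSimpleModule R A' := IsSimpleModule.congr eA.symm
  haveI := finite_of_submodule K A
  haveI := finite_of_submodule K A'
  have hdimA : finrank K A = finrank K A' := (eA.restrictScalars K).finrank_eq
  have hdimB : finrank K B = finrank K B' := by
    have h1 := finrank_add_finrank_of_isCompl K hAB
    have h2 := finrank_add_finrank_of_isCompl K hA'B'
    omega
  -- an atom either misses a submodule or lies inside it
  have key : ∀ (P X : Submodule R N) [IsSimpleModule R P], Disjoint X P ∨ P ≤ X := by
    intro P X _
    have hat := isSimpleModule_iff_isAtom.mp (inferInstance : IsSimpleModule R P)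
    rcases hat.le_iff.mp (inf_le_right : X ⊓ P ≤ P) with h | h
    · exact Or.inl (disjoint_iff.mpr h)
    · exact Or.inr (inf_eq_right.mp h)
  -- projecting along a disjoint atom gives an isomorphism
  have proj : ∀ (X Y X' Y' : Submodule R N), IsCompl X Y → IsCompl X' Y' → Disjoint Y X' →
      finrank K Y = finrank K Y' → Nonempty (Y ≃ₗ[R] Y') := by
    intro X Y X' Y' hXY hX'Y' hdis hdim
    haveI := finite_of_submodule K Y
    haveI := finite_of_submodule K Y'
    let π : Y →ₗ[R] Y' := (Submodule.projectionOnto Y' X' hX'Y'.symm) ∘ₗ Y.subtype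
    have hπ : Function.Injective π := by
      intro y₁ y₂ h
      have h' : π (y₁ - y₂) = 0 := by rw [map_sub, h, sub_self]
      have hmem : ((y₁ - y₂ : Y) : N) ∈ X' :=
        (Submodule.projectionOnto_apply_eq_zero_iff hX'Y'.symm).mp h'
      have := (Submodule.disjoint_def.mp hdis) _ (y₁ - y₂).2 hmem
      rw [← sub_eq_zero]
      exact Subtype.ext this
    obtain ⟨g, -⟩ := exists_linearEquiv_of_injective_of_finrank_eq K π hπ hdim
    exact ⟨g⟩
  rcases key A' B with h1 | h1
  · exact proj A B A' B' hAB hA'B' h1 hdimB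
  rcases key A B' with h2 | h2
  · obtain ⟨g⟩ := proj A' B' A B hA'B' hAB h2 hdimB.symm
    exact ⟨g.symm⟩
  -- both containments: `A' ≤ B`, `A ≤ B'`
  set D := B ⊓ B' with hD
  have hB : A' ⊔ D = B := by
    rw [hD, sup_comm, inf_sup_assoc_of_le B' h1, hA'B'.symm.sup_eq_top, inf_top_eq]
  have hB' : A ⊔ D = B' := by
    rw [hD, sup_comm, inf_comm, inf_sup_assoc_of_le B h2, hAB.symm.sup_eq_top, inf_top_eq]
  have hdis : Disjoint A' D := hA'B'.disjoint.mono_right inf_le_right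
  have hdis' : Disjoint A D := hAB.disjoint.mono_right inf_le_left
  obtain ⟨e1⟩ := nonempty_equiv_prod_of_disjoint_sup_eq (R := R) hdis hB
  obtain ⟨e2⟩ := nonempty_equiv_prod_of_disjoint_sup_eq (R := R) hdis' hB'
  exact ⟨e1 ≪≫ₗ (eA.symm.prodCongr (LinearEquiv.refl R D)) ≪≫ₗ e2.symm⟩

end Cancellation

section Subgrading

/-- **The complement inherits the grading.**  If `M = Z ⊕ C` and every homogeneous element
splits as `z + y` with `y ∈ C` homogeneous of the same degree, then the induced grading
`k ↦ C ∩ gr k` of `C` is again independent and exhaustive. [folklore] -/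
theorem iSupIndep_comap_subtype_of_isCompl (gr : ℕ → Submodule R M) (hind : iSupIndep gr)
    (hsup : ⨆ k, gr k = ⊤) (Z C : Submodule R M) (hZC : IsCompl Z C)
    (hdeg : ∀ k, ∀ x ∈ gr k, ∃ z ∈ Z, ∃ y ∈ C, y ∈ gr k ∧ x = z + y) :
    iSupIndep (fun k => (gr k).comap C.subtype) ∧ (⨆ k, (gr k).comap C.subtype) = ⊤ := by
  constructor
  · rw [iSupIndep_def]
    intro i
    rw [Submodule.disjoint_def]
    intro x hx hx'
    have h1 : (x : M) ∈ gr i := hx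
    have h2 : (x : M) ∈ ⨆ (j) (_ : j ≠ i), gr j := by
      have hle : (⨆ (j) (_ : j ≠ i), (gr j).comap C.subtype).map C.subtype ≤
          ⨆ (j) (_ : j ≠ i), gr j := by
        rw [Submodule.map_iSup]
        refine iSup_mono fun j => ?_
        rw [Submodule.map_iSup]
        exact iSup_mono fun _ => Submodule.map_comap_le _ _
      exact hle ⟨x, hx', rfl⟩
    have := (Submodule.disjoint_def.mp (iSupIndep_def.mp hind i)) _ h1 h2
    exact Subtype.ext this
  · rw [eq_top_iff]
    rintro y -
    let π : M →ₗ[R] C := Submodule.projectionOnto C Z hZC.symm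
    have key : ∀ x : M, x ∈ (⨆ k, gr k) → π x ∈ ⨆ k, (gr k).comap C.subtype := by
      intro x hx
      refine Submodule.iSup_induction gr (motive := fun x => π x ∈ ⨆ k, (gr k).comap C.subtype)
        hx ?_ ?_ ?_
      · intro k x hx
        obtain ⟨z, hz, y, hy, hyk, rfl⟩ := hdeg k x hx
        have h1 : π z = 0 := (Submodule.projectionOnto_apply_eq_zero_iff hZC.symm).mpr hz
        have h2 : π y = ⟨y, hy⟩ := Submodule.projectionOnto_apply_left hZC.symm ⟨y, hy⟩
        rw [map_add, h1, h2, zero_add]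
        exact (le_iSup (fun k => (gr k).comap C.subtype) k) hyk
      · rw [map_zero]; exact zero_mem _
      · intro x y hx hy
        rw [map_add]; exact add_mem hx hy
    have hy := key y (hsup ▸ Submodule.mem_top)
    have h3 : π y = y := Submodule.projectionOnto_apply_left hZC.symm y
    rwa [h3] at hy

end Subgrading

end Literature.RepresentationTheory.Semisimple
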